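import Summits.CriticalPhenomena.PercolationContinuityZ3.Theorems.PercNearOneGluingNoHeavyLowerTailFKAnalogues
import HarnessLib

/-!
# Connectivity correlation inequalities for `φ_{w,q}` conjectured for EVERY `q > 0` — STATEMENTS, conjecture nodes, and
# `HubCond ∧ TwoArmNeg ⇒ FourPoint` (file 1 of 3; consequences in `…AllQGluing.lean`, the `q ≥ 1` discharge in `…AllQOneLe.lean`)

Support file (`--supports stmt-CriticalPhenomena-4575`), FK sub-lane `prim-bschramm-fk-1` (gen 4) of the post-continuity
programme; builds on p205010 (kernel theorem, internal audit signed; external expert review pending).  No named facts, no sorries;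
standard axioms.

WHAT IS NEW.  Nothing is known in print about correlation inequalities for the random-cluster measure with `q < 1` on general
graphs (Grimmett 2006, §3.9).  The lane's exact computations (gen 4, memo `bschramm/FK-DEFS.md` §8 and
`bschramm/FROM-fk-1-g4-ALLQ-CONNECTIVITY-INEQUALITIES.md`: exhaustive COEFFICIENTWISE verification — nonnegative coefficients of the
difference polynomial in `(p_e, 1 − p_e, q)` graded by the total cluster count — on all weighted graphs with `≤ 6` vertices) support
the following statements for EVERY `q > 0`, stated here with the MEASURE as a parameter and as `q`-families (`φ = rcMeasureW w q ∅`):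

* `HubUnder μ o a b`        — `μ(o ↔ a) μ(b ↔ a) ≤ μ(Ω) μ(o ↔ a ↔ b)` (Harris for two connections THROUGH A COMMON VERTEX);
* `HubCondUnder μ o a b c`  — the same given `{a ↮ c}` (van den Berg–Häggström–Kahn Thm. 1.3 for connectivity events);
* `TwoArmNegUnder μ o a b c` — `μ(a ↮ c) μ(o ↔ a, b ↔ c, a ↮ c) ≤ μ(o ↔ a, a ↮ c) μ(b ↔ c, a ↮ c)` (vdBHK Thm. 1.4 for connectivity events);
* `FourPointUnder μ o a c b` — `μ{oa|cb} μ{oc|ab} ≤ μ{oab|c} μ{ocb|a}` for the exact partition patterns induced on `{o, a, c, b}`.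

PROVED HERE (kernel): (1) `HubCond ∧ TwoArmNeg ⇒ FourPoint` for any finite measure (Kozma–Nitzan's proof of their Theorem 1 in
product form); (2) `FourPoint ⇒` additive gluing for relay sets of size `≤ 2` and `FourPoint ⇒` the pre-FKG inequality (3) of
Kozma–Nitzan for `|A| = 2`, for any probability measure on the bond configurations of a finite vertex type; (3) all four statements for
`φ_{w,q}` with `q ≥ 1` (from the tree's vdBHK Thm. 2.1 for `rcMeasureW`, and FKG), hence `AdditiveGluingTwoFK q` for `q ≥ 1` by
this route; (4) the conjecture nodes `HubFKPos`, `HubCondFKPos`, `TwoArmNegFKPos`, `FourPointFKPos`, `AdditiveGluingTwoFKPos`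
(`∀ q > 0`) are recorded `@[conjecture]` (NOT asserted) together with the proved implications between them, so that a proof of
`HubCondFKPos ∧ TwoArmNegFKPos` closes `AdditiveGluingFKPos` (file `…FKAnalogues.lean`) for relay sets of size `≤ 2` by name.
Nothing is claimed for `q < 1` beyond these implications.
[cite: KozmaNitzan2024, Thm. 1 and eq. (3), (5), (6) (pp. 7–8); Conj. 1 (p. 3)] [cite: VandenbergHaggstromKahn2005, Thms. 1.3, 1.4, 2.1 (pp. 6–9)]
[cite: Grimmett2006, §1.4 eq. (1.20) (p. 15); Thm. (3.8); §3.9 (p. 63)]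
-/

noncomputable section

namespace Summit.CriticalPhenomena.PercolationContinuityZ3.Theorems

namespace FK

open MeasureTheory Set Literature.Probability.LatticeModels Literature.Probability.Percolation
open scoped Classical

variable {V : Type*}

/-! ### Events -/

/-- The separation event `{a ↮ c}`. [cite: VandenbergHaggstromKahn2005, §1 (p. 3)] -/
def sepEv (a c : V) : Set (BondConfig V) := {ω | ¬ (openGraph ω).Reachable a c}

/-- `{a ↮ c} = {c ↮ a}`. [folklore] -/
theorem sepEv_comm (a c : V) : (sepEv a c : Set (BondConfig V)) = sepEv c a := by
  ext ω; exact not_congr ⟨SimpleGraph.Reachable.symm, SimpleGraph.Reachable.symm⟩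

/-- Membership unfolding for `openConn`. [folklore] -/
theorem mem_openConn_iff' (x y : V) (ω : BondConfig V) : ω ∈ openConn x y ↔ (openGraph ω).Reachable x y := Iff.rfl

/-- Membership unfolding for `sepEv`. [folklore] -/
theorem mem_sepEv_iff (a c : V) (ω : BondConfig V) : ω ∈ sepEv a c ↔ ¬ (openGraph ω).Reachable a c := Iff.rfl

/-! ### The four statements, with the measure as a parameter -/

/-- **Hub inequality under `μ`**: `μ(o ↔ a)·μ(b ↔ a) ≤ μ(Ω)·μ(o ↔ a, b ↔ a)` — the two connections to the common vertex `a` are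
positively correlated (homogeneous form).  For `μ = φ_{w,q}`, `q ≥ 1` this is FKG; conjectured for every `q > 0`.
[cite: Grimmett2006, Thm. (3.8) (q ≥ 1); §3.9 (q < 1 open)] -/
def HubUnder (μ : Measure (BondConfig V)) (o a b : V) : Prop :=
  μ.real (openConn o a) * μ.real (openConn b a) ≤ μ.real univ * μ.real (openConn o a ∩ openConn b a)

/-- **Conditioned hub inequality under `μ`** (vdBHK Thm. 1.3 for the two connectivity events `{o ↔ a}`, `{b ↔ a}` of the cluster of
`a`, given `{a ↮ c}`), denominator-free. [cite: VandenbergHaggstromKahn2005, Thm. 1.3 (p. 6)] -/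
def HubCondUnder (μ : Measure (BondConfig V)) (o a b c : V) : Prop :=
  μ.real (openConn o a ∩ sepEv a c) * μ.real (openConn b a ∩ sepEv a c) ≤
    μ.real (sepEv a c) * μ.real (openConn o a ∩ openConn b a ∩ sepEv a c)

/-- **Two-arm negative correlation under `μ`** (vdBHK Thm. 1.4 for the connectivity events `{o ↔ a}` of `C_a` and `{b ↔ c}` of `C_c`,
given `{a ↮ c}`), denominator-free. [cite: VandenbergHaggstromKahn2005, Thm. 1.4 (p. 7)] -/
def TwoArmNegUnder (μ : Measure (BondConfig V)) (o a b c : V) : Prop :=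
  μ.real (sepEv a c) * μ.real (openConn o a ∩ openConn b c ∩ sepEv a c) ≤
    μ.real (openConn o a ∩ sepEv a c) * μ.real (openConn b c ∩ sepEv a c)

/-- **Four-point inequality under `μ`**: `μ{oa|cb}·μ{oc|ab} ≤ μ{oab|c}·μ{ocb|a}`, where `{oa|cb}` is the event that the open clusters
induce exactly the partition `{{o,a},{c,b}}` on the four points (written as `{o ↔ a} ∩ {b ↔ c} ∩ {a ↮ c}`), etc.  This is the product
form of Kozma–Nitzan's Theorem 1 argument. [cite: KozmaNitzan2024, Thm. 1, eq. (6) (pp. 7–8)] -/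
def FourPointUnder (μ : Measure (BondConfig V)) (o a c b : V) : Prop :=
  μ.real (openConn o a ∩ openConn b c ∩ sepEv a c) * μ.real (openConn o c ∩ openConn b a ∩ sepEv a c) ≤
    μ.real (openConn o a ∩ openConn b a ∩ sepEv a c) * μ.real (openConn o c ∩ openConn b c ∩ sepEv a c)

/-- **Kozma–Nitzan's pre-FKG inequality (3) for the relay pair `{a, c}` under `μ`**:
`μ(o ↔ b, o ↔ {a,c}) ≥ min (μ(o ↔ {a,c}, a ↔ b), μ(o ↔ {a,c}, c ↔ b))`. [cite: KozmaNitzan2024, eq. (3) (p. 3) with |A| = 2] -/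
def PreFKGPairUnder (μ : Measure (BondConfig V)) (o a c b : V) : Prop :=
  min (μ.real ((openConn o a ∪ openConn o c) ∩ openConn a b)) (μ.real ((openConn o a ∪ openConn o c) ∩ openConn c b)) ≤
    μ.real ((openConn o a ∪ openConn o c) ∩ openConn o b)

/-! ### (1) `HubCond ∧ TwoArmNeg ⇒ FourPoint` (Kozma–Nitzan, proof of Thm. 1, four applications of vdBHK) -/

/-- **Four conditional correlation inequalities give the four-point inequality** (any finite measure): from the conditioned hub
inequality at the hubs `a` and `c` and the two-arm negative correlation for the pairs `(o–a, b–c)` and `(o–c, b–a)`, all given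
`{a ↮ c}`.  This is exactly the chain of four vdBHK applications in Kozma–Nitzan's proof of their Theorem 1, written as one product
inequality. [cite: KozmaNitzan2024, proof of Thm. 1 (p. 8)] -/
theorem fourPointUnder_of_hubCond_twoArmNeg (μ : Measure (BondConfig V)) [IsFiniteMeasure μ] (o a c b : V)
    (h₁ : HubCondUnder μ o a b c) (h₂ : HubCondUnder μ o c b a)
    (h₃ : TwoArmNegUnder μ o a b c) (h₄ : TwoArmNegUnder μ o c b a) : FourPointUnder μ o a c b := by
  unfold FourPointUnder
  unfold HubCondUnder at h₁ h₂
  unfold TwoArmNegUnder at h₃ h₄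
  rw [← sepEv_comm a c] at h₂ h₄
  set P := μ.real (sepEv a c) with hP
  set α := μ.real (openConn o a ∩ sepEv a c)
  set β := μ.real (openConn b a ∩ sepEv a c)
  set γ := μ.real (openConn o c ∩ sepEv a c)
  set δ := μ.real (openConn b c ∩ sepEv a c)
  set x₃ := μ.real (openConn o a ∩ openConn b a ∩ sepEv a c)
  set x₄ := μ.real (openConn o c ∩ openConn b c ∩ sepEv a c)
  set x₆ := μ.real (openConn o a ∩ openConn b c ∩ sepEv a c)
  set x₇ := μ.real (openConn o c ∩ openConn b a ∩ sepEv a c)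
  have hα : 0 ≤ α := measureReal_nonneg
  have hβ : 0 ≤ β := measureReal_nonneg
  have hγ : 0 ≤ γ := measureReal_nonneg
  have hδ : 0 ≤ δ := measureReal_nonneg
  have hx₃ : 0 ≤ x₃ := measureReal_nonneg
  have hx₄ : 0 ≤ x₄ := measureReal_nonneg
  have hx₆ : 0 ≤ x₆ := measureReal_nonneg
  have hx₇ : 0 ≤ x₇ := measureReal_nonneg
  have hP0 : 0 ≤ P := measureReal_nonneg
  rcases hP0.eq_or_lt with hP0 | hPpos
  · -- `P = 0`: then `x₆ ≤ P = 0`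
    have hx₆P : x₆ ≤ P := measureReal_mono Set.inter_subset_right
    have hx₆0 : x₆ = 0 := le_antisymm (hx₆P.trans hP0.symm.le) hx₆
    rw [hx₆0, zero_mul]; exact mul_nonneg hx₃ hx₄
  · have hA : (P * x₆) * (P * x₇) ≤ (α * δ) * (γ * β) :=
      mul_le_mul h₃ h₄ (mul_nonneg hPpos.le hx₇) (mul_nonneg hα hδ)
    have hB : (α * β) * (γ * δ) ≤ (P * x₃) * (P * x₄) :=
      mul_le_mul h₁ h₂ (mul_nonneg hγ hδ) (mul_nonneg hPpos.le hx₃)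
    have hC : P * P * (x₆ * x₇) ≤ P * P * (x₃ * x₄) := by nlinarith [hA, hB]
    exact le_of_mul_le_mul_left hC (mul_pos hPpos hPpos)

/-! ### The `q`-families for `φ_{w,q}` and the conjecture nodes (all `q > 0`) -/

/-- **Hub inequality for `φ_{w,q}`** on every finite weighted graph. Proved below for `q ≥ 1`; conjectured for all `q > 0`
(`HubFKPos`). [cite: Grimmett2006, Thm. (3.8); §3.9] -/
def HubFK (q : ℝ) : Prop := ∀ (n : ℕ) (w : Sym2 (Fin n) → unitInterval) (o a b : Fin n), HubUnder (rcMeasureW w q ∅) o a b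

/-- **Conditioned hub inequality for `φ_{w,q}`**. [cite: VandenbergHaggstromKahn2005, Thm. 1.3 (p. 6)] -/
def HubCondFK (q : ℝ) : Prop :=
  ∀ (n : ℕ) (w : Sym2 (Fin n) → unitInterval) (o a b c : Fin n), HubCondUnder (rcMeasureW w q ∅) o a b c

/-- **Two-arm negative correlation for `φ_{w,q}`**. [cite: VandenbergHaggstromKahn2005, Thm. 1.4 (p. 7)] -/
def TwoArmNegFK (q : ℝ) : Prop :=
  ∀ (n : ℕ) (w : Sym2 (Fin n) → unitInterval) (o a b c : Fin n), TwoArmNegUnder (rcMeasureW w q ∅) o a b c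

/-- **Four-point inequality for `φ_{w,q}`**. [cite: KozmaNitzan2024, Thm. 1 (p. 7)] -/
def FourPointFK (q : ℝ) : Prop :=
  ∀ (n : ℕ) (w : Sym2 (Fin n) → unitInterval) (o a c b : Fin n), FourPointUnder (rcMeasureW w q ∅) o a c b

/-- **Additive gluing for `φ_{w,q}` and relay sets of size `≤ 2`** (the `|A| ≤ 2` slice of `AdditiveGluingFK q`).
[cite: KozmaNitzan2024, Conj. 1 (p. 3), Thm. 1 (p. 7)] -/
def AdditiveGluingTwoFK (q : ℝ) : Prop :=
  ∀ (n : ℕ) (w : Sym2 (Fin n) → unitInterval) (A : Finset (Fin n)) (o b : Fin n), A.card ≤ 2 →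
    AdditiveGluingUnder (rcMeasureW w q ∅) A o b

/-- The full statement restricts to the two-point slice. [folklore] -/
theorem additiveGluingTwoFK_of_additiveGluingFK {q : ℝ} (h : AdditiveGluingFK q) : AdditiveGluingTwoFK q :=
  fun n w A o b _ => (additiveGluingFK_iff_under q).1 h n w A o b

/-- **`HubCond ∧ TwoArmNeg ⇒ FourPoint` for `φ_{w,q}`**, any `q > 0`. [cite: KozmaNitzan2024, proof of Thm. 1 (p. 8)] -/
theorem fourPointFK_of_hubCond_twoArmNeg {q : ℝ} (hq : 0 < q) (h₁ : HubCondFK q) (h₂ : TwoArmNegFK q) : FourPointFK q := by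
  intro n w o a c b
  haveI := isProbabilityMeasure_rcMeasureW w hq (∅ : Set (Fin n))
  exact fourPointUnder_of_hubCond_twoArmNeg _ o a c b (h₁ n w o a b c) (h₁ n w o c b a) (h₂ n w o a b c) (h₂ n w o c b a)

/-- **Hub inequality for every `q > 0`.**  CONJECTURE-SHAPED STATEMENT, NOT asserted.  Evidence (gen 4, 2026-08-20): the difference
`φ(o↔a↔b)·Z − φ(o↔a)φ(b↔a)·Z` (times `Z²`) has NONNEGATIVE coefficients as a polynomial in `(p_e, 1−p_e, q)` graded by total cluster
count, exhaustively on `K_n`, `n ≤ 6` (all weighted graphs on `≤ 6` vertices; 0 of 22,186,830 monomials deficient at `n = 6`, kit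
j100666); the same test for two EDGE events at a common vertex fails (as FKG does for `q < 1`).  No THEOREM in print for `q < 1`
(Grimmett 2006 §3.9), but the statement is a PRINTED OPEN PROBLEM: `HubFK q` at `(o,a,b)` is Ayyer–Linusson–Ravichandran
(arXiv:2509.18788) §7 eq. (13)/(14) at `(u,w,v)` ('open even for the arboreal gas measure'), and along `w_e = λq/(1+λq)`, `q ↓ 0`,
`HubFKPos` gives their Conjecture 7.1, eq. (15), for the arboreal gas; ALR prove the outerplanar arboreal-gas case (Thm. 5.3).  In the
tree: `HubFKPos` follows from edge-negative association for `q < 1` (`hubFKPos_of_edgeNegCorrFKLtOne`, fk-2) and holds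
unconditionally on series–parallel (2-tree) supports (`hubUnder_of_isTwoTree`, fk-1 gen 5).
[cite: AyyerLinussonRavichandran2025, §7 eq. (13)–(15), Conj. 7.1, Thm. 5.3 (p. 22)] [cite: Grimmett2006, §3.9 (p. 63); Thm. (3.8)] -/
@[conjecture] def HubFKPos : Prop := ∀ q : ℝ, 0 < q → HubFK q

/-- **Conditioned hub inequality for every `q > 0`.**  CONJECTURE-SHAPED STATEMENT, NOT asserted (coefficientwise-verified on
`K_n`, `n ≤ 7`: 0 of 69,044,785 monomials deficient at `n = 7`, kit j101269).  At `q = 1` this is van den Berg–Kahn 2001 Thm. 1.1 /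
vdBHK Thm. 1.3; for `q < 1` no printed statement was found as far as searched (corpus + galaxy + desk) — the unconditioned form is
Ayyer–Linusson–Ravichandran's open problem §7 (13)–(15). [cite: VandenbergHaggstromKahn2005, Thm. 1.3 (p. 6)]
[cite: AyyerLinussonRavichandran2025, §7 eq. (13)–(15), Conj. 7.1 (p. 22)] [cite: Grimmett2006, §3.9 (p. 63)] -/
@[conjecture] def HubCondFKPos : Prop := ∀ q : ℝ, 0 < q → HubCondFK q

/-- **Two-arm negative correlation for every `q > 0`.**  CONJECTURE-SHAPED STATEMENT, NOT asserted (coefficientwise-verified on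
`K_n`, `n ≤ 6`: 0 of 122,182 monomials deficient at `n = 6`). [cite: VandenbergHaggstromKahn2005, Thm. 1.4 (p. 7)]
[cite: Grimmett2006, §3.9 (p. 63)] -/
@[conjecture] def TwoArmNegFKPos : Prop := ∀ q : ℝ, 0 < q → TwoArmNegFK q

/-- **Four-point inequality for every `q > 0`.**  CONJECTURE-SHAPED STATEMENT, NOT asserted (coefficientwise-verified on `K_n`,
`n ≤ 6`: 0 of 9,141 monomials deficient at `n = 6`; implied by `HubCondFKPos ∧ TwoArmNegFKPos`).
[cite: KozmaNitzan2024, Thm. 1 (p. 7)] [cite: Grimmett2006, §3.9 (p. 63)] -/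
@[conjecture] def FourPointFKPos : Prop := ∀ q : ℝ, 0 < q → FourPointFK q

/-- **Additive gluing for relay sets of size `≤ 2`, every `q > 0`** — the `|A| ≤ 2` slice of `AdditiveGluingFKPos`.
CONJECTURE-SHAPED STATEMENT, NOT asserted; implied by `FourPointFKPos`. [cite: KozmaNitzan2024, Conj. 1 (p. 3)] -/
@[conjecture] def AdditiveGluingTwoFKPos : Prop := ∀ q : ℝ, 0 < q → AdditiveGluingTwoFK q

/-- The implication between the conjecture nodes: conditioned hub + two-arm negative correlation give the four-point inequality.
[cite: KozmaNitzan2024, proof of Thm. 1 (p. 8)] -/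
theorem fourPointFKPos_of (h₁ : HubCondFKPos) (h₂ : TwoArmNegFKPos) : FourPointFKPos :=
  fun q hq => fourPointFK_of_hubCond_twoArmNeg hq (h₁ q hq) (h₂ q hq)

/-- `AdditiveGluingFKPos` (all relay sets) gives the two-point slice. [folklore] -/
theorem additiveGluingTwoFKPos_of_additiveGluingFKPos (h : AdditiveGluingFKPos) : AdditiveGluingTwoFKPos :=
  fun q hq => additiveGluingTwoFK_of_additiveGluingFK (h q hq)

/-! ### Appendix (gen 4, later the same day): pairwise positive correlation of ALL two-point connection events -/

/-- **Pairwise positive correlation of two-point connection events under `μ`** (homogeneous form):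
`μ(x ↔ y)·μ(u ↔ v) ≤ μ(Ω)·μ(x ↔ y, u ↔ v)` for ARBITRARY vertices `x, y, u, v` — `HubUnder μ o a b` is the case `(x,y,u,v) = (o,a,b,a)`.
For `μ = φ_{w,q}`, `q ≥ 1` this is FKG; conjectured for every `q > 0` (`PairConnPosFKPos`). [cite: Grimmett2006, Thm. (3.8); §3.9 (p. 63)] -/
def PairConnPosUnder (μ : Measure (BondConfig V)) (x y u v : V) : Prop :=
  μ.real (openConn x y) * μ.real (openConn u v) ≤ μ.real univ * μ.real (openConn x y ∩ openConn u v)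

/-- The hub inequality is the pair inequality with a shared endpoint. [folklore] -/
theorem hubUnder_of_pairConnPosUnder (μ : Measure (BondConfig V)) (o a b : V) (h : PairConnPosUnder μ o a b a) :
    HubUnder μ o a b := h

/-- **Pairwise positive correlation of two-point connection events for `φ_{w,q}`**, every finite weighted graph.
[cite: Grimmett2006, Thm. (3.8); §3.9 (p. 63)] -/
def PairConnPosFK (q : ℝ) : Prop :=
  ∀ (n : ℕ) (w : Sym2 (Fin n) → unitInterval) (x y u v : Fin n), PairConnPosUnder (rcMeasureW w q ∅) x y u v

/-- `PairConnPosFK q → HubFK q`. [folklore] -/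
theorem hubFK_of_pairConnPosFK {q : ℝ} (h : PairConnPosFK q) : HubFK q :=
  fun n w o a b => hubUnder_of_pairConnPosUnder _ o a b (h n w o a b a)

/-- **Pairwise positive correlation of two-point connection events for every `q > 0`** — `φ(x↔y, u↔v) ≥ φ(x↔y)φ(u↔v)` for
every random-cluster measure `φ_{G,w,q}`, `q > 0`, and all vertices `x, y, u, v`.  CONJECTURE-SHAPED STATEMENT, NOT asserted.
For `q ≥ 1` it is FKG (`pairConnPosFK_of_one_le` in `…AllQOneLe.lean`'s successor / immediate from `rcMeasureW_fkg`); for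
`q < 1` edges are (conjecturally) NEGATIVELY correlated (Grimmett 2006 §3.9) while — evidence of this lane, gen 4, 2026-08-20 —
CONNECTION events appear to stay positively correlated: the difference polynomial is coefficientwise nonnegative in `(p_e, 1−p_e, q^k)`
for disjoint pairs `{0↔2},{1↔3}` (K_5: 0/87,070 monomials), shared-endpoint pairs (= `HubFKPos`, K_6: 0/22,186,830), nested and
multi-block variants (`{0↔1↔2}` vs `{3↔4}`, `{0↔1,2↔3}` vs `{1↔2,3↔4}`, …: 0 deficits on K_5), whereas UNIONS of connection events
(`{2↔3 ∨ 2↔4}`), two-point HUB SETS, set-conditioning and edge events all fail for `q < 1`.  Equivalent reading: the survival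
function `π ↦ φ(every block of π is connected)` on the partition lattice is supermultiplicative, `S(π ∨ π') ≥ S(π)S(π')`, for every
`q > 0` (full log-supermodularity `S(π∨π')S(π∧π') ≥ S(π)S(π')` is FALSE already coefficientwise at `q = 1`).
[cite: Grimmett2006, §3.9 (p. 63); Thm. (3.8)] -/
@[conjecture] def PairConnPosFKPos : Prop := ∀ q : ℝ, 0 < q → PairConnPosFK q

/-- The pair conjecture contains the hub conjecture. [folklore] -/
theorem hubFKPos_of_pairConnPosFKPos (h : PairConnPosFKPos) : HubFKPos :=
  fun q hq => hubFK_of_pairConnPosFK (h q hq)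

/-- **Pairwise positive correlation for `φ_{w,q}`, `q ≥ 1`** — FKG (`rcMeasureW_fkg`) for the increasing events `{x ↔ y}`, `{u ↔ v}`.
[cite: Grimmett2006, Thm. (3.8)] -/
theorem pairConnPosFK_of_one_le {q : ℝ} (hq : 1 ≤ q) : PairConnPosFK q := by
  intro n w x y u v
  have hq0 : 0 < q := one_pos.trans_le hq
  haveI := isProbabilityMeasure_rcMeasureW w hq0 (∅ : Set (Fin n))
  unfold PairConnPosUnder
  rw [probReal_univ, one_mul]
  exact rcMeasureW_fkg w hq ∅ (fun _ _ h hω => SimpleGraph.Reachable.mono (SimpleGraph.fromEdgeSet_mono h) hω)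
    (fun _ _ h hω => SimpleGraph.Reachable.mono (SimpleGraph.fromEdgeSet_mono h) hω)

end FK

end Summit.CriticalPhenomena.PercolationContinuityZ3.Theorems

end
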